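import Literature.AlgebraicGeometry.Resolution.MuPTorsorLocalUniformizationNonAbhyankar
import Summits.ResolutionOfSingularities.ResolutionOfSingularities.Theorems.SoloInformedAllFields
import HarnessLib

/-!
# Resolution in characteristic `p` from `μ_p`-torsor steps at non-Abhyankar valuations

Summit-side consequences of `Literature/…/MuPTorsorLocalUniformizationNonAbhyankar.lean`
(Temkin 2013 (relative form) + Cutkosky 2022, Thm. 1.3, the latter PROVED in the tree):

* `muPTorsorStepsAt_nonAbhyankar_of_resolutionInChar` — resolution in characteristic `p` implies
  the torsor steps at every valuation ring, in particular at the non-Abhyankar ones (trivial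
  direction, recorded for the equivalence below);
* `hasResolution_of_muPTorsorStepsAt_nonAbhyankar_of_projPatching` — over an ARBITRARY field `k`
  of characteristic `p`: `Temkin2013Relative` + the `μ_p`-torsor steps at the NON-Abhyankar
  valuation rings of finitely generated extensions of `k` + two-model patching of projective
  models over `k` ⇒ weak resolution of every reduced separated `k`-scheme of finite type.
  Abhyankar valuations need no hypothesis (Cutkosky 2022).
* `resolutionInChar_localProxy_nonAbhyankar` — the exact local proxy: given `Temkin2013Relative`,
  `LocalUniformizationInChar p` is equivalent to the torsor steps at non-Abhyankar valuations.
-/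

noncomputable section

namespace Summit.ResolutionOfSingularities.ResolutionOfSingularities.Theorems

open CategoryTheory AlgebraicGeometry IsLocalRing
open Literature.AlgebraicGeometry Literature.AlgebraicGeometry.Resolution

universe u

/-- Resolution in characteristic `p` implies the `μ_p`-torsor steps at the non-Abhyankar
valuation rings (indeed at all of them). -/
theorem muPTorsorStepsAt_nonAbhyankar_of_resolutionInChar {p : ℕ} (h : ResolutionInChar.{u} p)
    (k K : Type u) [Field k] [CharP k p] [Field K] [Algebra k K]
    (_hfg : (⊤ : IntermediateField k K).FG) (O : ValuationSubring K)
    (_hk : ∀ c : k, algebraMap k K c ∈ O)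
    (_hA : ¬ IsAbhyankarPlace O (algebraMap k K).fieldRange ⊤) : MuPTorsorStepsAt p k O :=
  muPTorsorLocalUniformizationInChar_of_resolutionInChar h k K O

/-- **Torsor steps at non-Abhyankar valuations over `k` + Temkin (relative) + patching ⇒
resolution over `k`**, for an arbitrary field `k` of characteristic `p`. -/
theorem hasResolution_of_muPTorsorStepsAt_nonAbhyankar_of_projPatching {p : ℕ} [Fact p.Prime]
    (hT : Temkin2013Relative.{u}) {k : Type u} [Field k] [CharP k p]
    (H : ∀ (K : Type u) [Field K] [Algebra k K], (⊤ : IntermediateField k K).FG →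
      ∀ O : ValuationSubring K, (∀ c : k, algebraMap k K c ∈ O) →
        ¬ IsAbhyankarPlace O (algebraMap k K).fieldRange ⊤ → MuPTorsorStepsAt p k O)
    (hZ : ∀ (K : Type u) [Field K] [Algebra k K] [Algebra.EssFiniteType k K],
      ∀ M₁ M₂ : ProjModel k K,
        ∃ (N : ProjModel k K) (φ₁ : N.Hom M₁) (φ₂ : N.Hom M₂), φ₁.RegLe ∧ φ₂.RegLe)
    (X : Scheme.{u}) (f : X ⟶ Spec (.of k)) (hs : IsSeparated f) (hl : LocallyOfFiniteType f)
    (hq : QuasiCompact f) (hr : IsReduced X) : Scheme.HasResolution X := by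
  haveI : QuasiCompact f := hq
  haveI : LocallyOfFiniteType f := hl
  haveI : CompactSpace X := QuasiCompact.compactSpace_of_compactSpace f
  obtain ⟨d, hd⟩ := exists_topologicalKrullDim_le_of_locallyOfFiniteType f
  have hU : ∀ (K : Type u) [Field K] [Algebra k K] (A₀ : Subalgebra k K), A₀.FG →
      IsFractionRing A₀ K → ∀ v : ZariskiRiemannSpace k K, ∃ T : Subalgebra k K,
        (T.FG ∧ IsFractionRing T K) ∧ ZariskiRiemannSpace.HasRegularCentre T v := by
    intro K _ _ A₀ hA₀fg hA₀fr v
    haveI : Algebra.FiniteType k A₀ := A₀.fg_iff_finiteType.mp hA₀fg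
    haveI : Algebra.EssFiniteType A₀ K :=
      Algebra.EssFiniteType.of_isLocalization K (nonZeroDivisors A₀)
    have hKfg : (⊤ : IntermediateField k K).FG :=
      IntermediateField.fg_top_iff.mpr (Algebra.EssFiniteType.comp k A₀ K)
    exact exists_hasRegularCentre_of_lu
      (fun O hO => isLocallyUniformizable_of_abhyankar_or_muPTorsorStepsAt hT hKfg O hO
        (H K hKfg O hO)) v
  refine ResolutionOverUpToDim.of_projective (k := k) (d := d) (fun _ Y ι hι hint _ => ?_)
    X f hs hl hq hr hd
  haveI := hι
  haveI := hint
  exact hasResolution_of_twoModelPatching_of_uniformizable hZ hU Y ι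

/-- The same, packaged as `ResolutionOverUpToDim k d` for every `d`. -/
theorem resolutionOverUpToDim_of_muPTorsorStepsAt_nonAbhyankar_of_projPatching {p : ℕ}
    [Fact p.Prime] (hT : Temkin2013Relative.{u}) {k : Type u} [Field k] [CharP k p]
    (H : ∀ (K : Type u) [Field K] [Algebra k K], (⊤ : IntermediateField k K).FG →
      ∀ O : ValuationSubring K, (∀ c : k, algebraMap k K c ∈ O) →
        ¬ IsAbhyankarPlace O (algebraMap k K).fieldRange ⊤ → MuPTorsorStepsAt p k O)
    (hZ : ∀ (K : Type u) [Field K] [Algebra k K] [Algebra.EssFiniteType k K],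
      ∀ M₁ M₂ : ProjModel k K,
        ∃ (N : ProjModel k K) (φ₁ : N.Hom M₁) (φ₂ : N.Hom M₂), φ₁.RegLe ∧ φ₂.RegLe)
    (d : ℕ) : ResolutionOverUpToDim k d :=
  fun X f hs hl hq hr _ =>
    hasResolution_of_muPTorsorStepsAt_nonAbhyankar_of_projPatching hT H hZ X f hs hl hq hr

/-- **Exact local proxy, non-Abhyankar form.** Given `Temkin2013Relative`: resolution in
characteristic `p` implies, and local uniformization in characteristic `p` is equivalent to,
the `μ_p`-torsor steps at the non-Abhyankar valuation rings over all ground fields of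
characteristic `p`. -/
theorem resolutionInChar_localProxy_nonAbhyankar {p : ℕ} [Fact p.Prime]
    (hT : Temkin2013Relative.{u}) :
    (ResolutionInChar.{u} p →
      ∀ (k K : Type u) [Field k] [CharP k p] [Field K] [Algebra k K],
        (⊤ : IntermediateField k K).FG →
        ∀ O : ValuationSubring K, (∀ c : k, algebraMap k K c ∈ O) →
          ¬ IsAbhyankarPlace O (algebraMap k K).fieldRange ⊤ → MuPTorsorStepsAt p k O) ∧
    (LocalUniformizationInChar.{u} p ↔
      ∀ (k K : Type u) [Field k] [CharP k p] [Field K] [Algebra k K],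
        (⊤ : IntermediateField k K).FG →
        ∀ O : ValuationSubring K, (∀ c : k, algebraMap k K c ∈ O) →
          ¬ IsAbhyankarPlace O (algebraMap k K).fieldRange ⊤ → MuPTorsorStepsAt p k O) :=
  ⟨fun h k K _ _ _ _ hfg O hk hA =>
      muPTorsorStepsAt_nonAbhyankar_of_resolutionInChar h k K hfg O hk hA,
    localUniformizationInChar_iff_muPTorsorStepsAt_nonAbhyankar hT⟩

end Summit.ResolutionOfSingularities.ResolutionOfSingularities.Theorems

end
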